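import Literature.Computability.AlgebraicComplexity.FSV18Thm9OfTopFanIn
import Literature.Computability.AlgebraicComplexity.FSV18Thm48TopFanInHolds
import HarnessLib

/-!
# FSV 2018 Thm. 9 (= ToC Thm. 1.10) — the named facts `FSV2018_thm9_occur` and `FSV2018_thm9`
# DISCHARGED (val-lit N1 row, unconditional)

Forbes–Shpilka–Volk, *Succinct hitting sets and barriers to proving lower bounds for algebraic
circuits* [ForbesShpilkaVolk2018], Theory of Computing 14(18) (2018) (arXiv:1701.05328), Theorem 9
(seq.) = ToC Thm. 1.10 ("succinct generators" — `poly(log s, n)`-size multilinear `ΣΠΣ` hitting-set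
generators exist for the seven restricted classes of the theorem), typed as the named fact
`FSV2018_thm9` (`FSV18SuccinctGenerators`, the conjunction of the seven per-class facts) with the
occur-`k` bullet `FSV2018_thm9_occur` in its SAFE characteristic reading (RULING (33) STEP 2, p458878:
`char = 0 ∨ s^R < char`, the clause [ASSS16] §4 prints).

With the keystone `FSV2018_thm48_topFanIn_holds` (`FSV18Thm48TopFanInHolds`: [ASSS16] §4,
Thm. dDkrPIT re-proved on FSV's formula model) the conditional glue of `FSV18Thm9OfTopFanIn`
(`FSV2018_thm9_occur_of_thm48_topFanIn`, `FSV2018_thm9_of_thm48_topFanIn` — the other six bullets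
were already theorems: `FSV2018_thm9_spsk_holds`, the `smesp`/`ΣΠ`/comm-ROABP/… discharges) closes
both facts unconditionally:

* `FSV2018_thm9_occur_holds : FSV2018_thm9_occur`;
* `FSV2018_thm9_holds : FSV2018_thm9`.

Theorem-only, no definitions, no named facts; net debt `−2`. Honest framing: FSV Thm. 9 is a
published theorem, here kernel-checked on the tree's typed model (provenance caveats B21/B23 of the
verbatim quotations `FSV2018_thm48` / `FSV2018_cor49` are bypassed, not resolved: those two facts
stay as typed); for V4 this is the N1 row (succinct generators EXIST for these restricted classes);
the rung's class `VP` is open, `VP ≠ VNP` is NOT proved and nothing here is progress on it.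
bears_on: V4 (N1).

## References
* [ForbesShpilkaVolk2018] Thm. 9 (seq.) = ToC Thm. 1.10; Thm. 48 (seq.) = ToC Thm. 5.24; Cor. 49.
  Locator: paper:arxiv-1701.05328 p0011.txt:L1–L16 (Thm. 9);
  paper:doi-10-4086-toc-2018-v014a018 p0014.txt:L42–p0015.txt:L8 (ToC Thm. 1.10).
* [AgrawalEtAl2011] arXiv:1111.0582 §4 (Thm. dDkrPIT) — the construction behind the occur bullet.
-/

namespace Literature.Computability.AlgebraicComplexity

/-- **FSV Thm. 9, occur-`k` bullet (SAFE characteristic reading), DISCHARGED**: for every `D, k`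
there are `c, R` such that over every infinite field with `char = 0 ∨ s^R < char` the class of
`n`-variate polynomials computed by size-`s` depth-`D` occur-`k` formulas has a
`(⌈log₂ s⌉ + n + 2)^c`-size multilinear `ΣΠΣ` hitting-set generator.
[cite: ForbesShpilkaVolk2018, Thm. 9 (seq.) = ToC Thm. 1.10 (bullet "depth-D occur-k formulas"); AgrawalEtAl2011, §4 (Thm. dDkrPIT)] -/
theorem FSV2018_thm9_occur_holds : FSV2018_thm9_occur :=
  FSV2018_thm9_occur_of_thm48_topFanIn FSV2018_thm48_topFanIn_holds

/-- **FSV Thm. 9 (= ToC Thm. 1.10), all seven bullets, DISCHARGED** (the N1 row of the val-lit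
audit, unconditional). [cite: ForbesShpilkaVolk2018, Thm. 9 (seq.) = ToC Thm. 1.10] -/
theorem FSV2018_thm9_holds : FSV2018_thm9 :=
  FSV2018_thm9_of_thm48_topFanIn FSV2018_thm48_topFanIn_holds

end Literature.Computability.AlgebraicComplexity
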